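import Mathlib.Data.Fintype.Pi
import Mathlib.Data.Finset.Card
import Mathlib.Data.Fin.Tuple.Basic
import Mathlib.Order.Basic
import HarnessLib

/-!
# Down-shifts (down-compressions) of families of cube points — definitions

Definitions file (cell `prim-bnk`, seat bnk-2 gen 21; `--supports stmt-CriticalPhenomena-4575`; proof write-up
`run/shared/lean/prim/prim-l12/PROOF-F-inequality.md`).  Objects used by the proof of the comb inequality `K(A,B,G) ≥ 0` for ALL
monotone third events (hence the master-family `F`-inequality for all increasing `G`):

* `SahiFComb.dn i X` — the elementary down-shift of a family `X ⊆ (Fin n → Bool)` along coordinate `i`: in every pair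
  `{y with y i = false, y with y i = true}` a lone upper point is moved down;
* `SahiFComb.dnSeq s X` — iterated down-shift along a list of coordinates (head first);
* `SahiFComb.sec c t X` — the `c = t` section of a family of points of the `(n+1)`-cube, as a family of points of the `n`-cube;
* `SahiFComb.flipOn J x` — reflection of the coordinates in `J` (for `J = univ`: the antipode);
* `SahiFComb.zeta x y` / `SahiFComb.disj x y` — the inclusion kernel `[x ≤ y]` and the disjointness kernel `[x ∧ y = 0]` as integers;
  `SahiFComb.wt x` — the number of `true` coordinates.
[this work]
-/

namespace Summit.CriticalPhenomena.PercolationContinuityZ3.Theorems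

namespace SahiFComb

variable {n : ℕ}

/-- Elementary down-shift of the family `X` along coordinate `i`: a point `x` with `x i = false` belongs to `dn i X` iff `x` or its
upper partner `update x i true` belongs to `X`; a point with `x i = true` belongs iff both it and its lower partner belong to `X`.
[folklore] -/
def dn (i : Fin n) (X : Finset (Fin n → Bool)) : Finset (Fin n → Bool) :=
  Finset.univ.filter (fun x => (x i = false ∧ (x ∈ X ∨ Function.update x i true ∈ X)) ∨
    (x i = true ∧ x ∈ X ∧ Function.update x i false ∈ X))

/-- Iterated down-shift along the list `s` of coordinates, head first: `dnSeq [i₁,…,i_t] = dn i_t ∘ ⋯ ∘ dn i₁`. [folklore] -/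
def dnSeq (s : List (Fin n)) (X : Finset (Fin n → Bool)) : Finset (Fin n → Bool) :=
  s.foldl (fun Y i => dn i Y) X

/-- The `c = t` section of a family of points of the `(n+1)`-cube. [folklore] -/
def sec (c : Fin (n + 1)) (t : Bool) (X : Finset (Fin (n + 1) → Bool)) : Finset (Fin n → Bool) :=
  Finset.univ.filter (fun y => Fin.insertNth c t y ∈ X)

/-- Reflect the coordinates in `J`. [folklore] -/
def flipOn (J : Finset (Fin n)) (x : Fin n → Bool) : Fin n → Bool :=
  fun k => if k ∈ J then !x k else x k

/-- The inclusion kernel `[x ≤ y]` (pointwise: `x i = true → y i = true`) as an integer. [folklore] -/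
def zeta (x y : Fin n → Bool) : ℤ := if (∀ i, x i = true → y i = true) then 1 else 0

/-- The disjointness kernel `[x ∧ y = 0]` (no common `true` coordinate) as an integer. [folklore] -/
def disj (x y : Fin n → Bool) : ℤ := if (∀ i, ¬ (x i = true ∧ y i = true)) then 1 else 0

/-- Number of `true` coordinates. [folklore] -/
def wt (x : Fin n → Bool) : ℕ := (Finset.univ.filter (fun i => x i = true)).card

end SahiFComb

end Summit.CriticalPhenomena.PercolationContinuityZ3.Theorems
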